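import Literature.NumberTheory.GaussSums.StickelbergerSubfieldAnnihilation
import Literature.NumberTheory.GaussSums.StickelbergerFactorisationIdeal
import Literature.NumberTheory.NumberFields.RelNormGaloisProduct
import Literature.NumberTheory.NumberFields.ImaginaryAbelianFieldOddChiClassNumber
import HarnessLib

/-!
# The Herbrand direction WITHOUT Mazur–Wiles: `(b − χ(b))·B_{1,χ⁻¹}` annihilates `e_ψ(ℤ_p ⊗ Cl K)` for `K ⊇ K₁ ⊆ ℚ(μ_f)`, by Stickelberger's theorem (Lang Ch. 1 §3 Thm. 3.1; Washington Thm. 6.10, §6.3)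

Topic `Literature/NumberTheory/NumberFields`, namespace `Literature.NumberTheory.NumberFields.HerbrandStickelberger`.
THEOREMS ONLY (no definition, no named fact, no `sorry`; D-0014 ∕ D-0026: net debt 0). Sequel BY NAME of
`GaussSums/StickelbergerSubfieldAnnihilation.lean` (Stickelberger's theorem for an abelian field `K₁ ⊆ ℚ(μ_f)`:
`JacobiSumIdeal.mk0_prod_comap_pow_stickelberger_subfield_eq_one`, `comap_map_algebraMap_eq`), of
`NumberFields/RelNormGaloisProduct.lean` (`N_{K/K₁}(𝔞)𝓞_K = ∏_{h ∈ Gal(K/K₁)} h𝔞`, Neukirch III (1.6) (iv)),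
of `NumberFields/ClassGroupUnitsGaloisModules.lean` (`classGroupRep`, `pClassGroupRep`,
`classGroupChiComponent ℚ K p ψ = e_ψ(ℤ_p ⊗ Cl K)`) and of `NumberFields/ImaginaryAbelianFieldOddChiClassNumber.lean`
(`mem_classGroupChiComponent_iff`: for `p ∤ [K:ℚ]` the `ψ`-component is the `ψ`-eigenspace).

## Source

S. Lang, *Cyclotomic Fields I and II*, GTM 121 (1990), Ch. 1 §3 (held `book:lang1990-cyclotomic-fields-i-ii`,
pp. 27–28): «**Theorem 3.1.** For non-trivial `χ`, the ideal `B_{1,χ̄} I_χ` annihilates `𝒞^{(p)}(χ)`» — for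
`ℚ(μ_m)`, `p ∤ φ(m)`, `I` the ideal of `ℤ[G]` generated by the `σ_b − b`, with the computation
`(b − σ_b)θ ε(χ) = (b − χ(b))B_{1,χ̄} ε(χ)` — and «**Corollary 3 (Herbrand's theorem).** … If `𝒞^{(p)}(χ) ≠ 0`,
then `p ∣ B_k`»; «If `p` does not divide `B_k`, it follows that `B_{1,χ̄}` is a `p`-unit, whence `𝒞^{(p)}(χ) = 0`».
L. C. Washington, *Introduction to Cyclotomic Fields*, 2nd ed. (1997), Thm. 6.10 (Stickelberger for abelian
`K ⊆ ℚ(ζ_m)`) and §6.3 (the `χ`-components; cite only).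

## What is proved (all sorry-free)

Setting: `K/ℚ` Galois (a number field in `Type`), `K₁` a normal subfield (`Algebra K₁ K`, `IsScalarTower ℚ K₁ K`,
`IsGalois K₁ K`) which embeds in `M = ℚ(μ_f)` (`IsCyclotomicExtension {f} ℚ M`, `Algebra K₁ M`,
`IsScalarTower ℚ K₁ M`, `IsGalois K₁ M`); `c = Rat.galEquivZMod f M : Gal(M/ℚ) ≅ (ℤ/f)ˣ`; for `b ∈ ℕ` and
`τ ∈ Gal(K₁/ℚ)` the exponent `E_b(τ) = Σ_{σ ∈ Gal(M/ℚ), σ|_{K₁} = τ} ⌊b·c(σ)/f⌋` (the coefficient of `τ⁻¹` in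
`res_{K₁} (b − σ_b)θ(f)`); all products/sums are spelled out (no definition is introduced).
* §1 `prod_filter_comap_eq_map_comap_relNorm` — **`∏_{g ∈ Gal(K/ℚ), g|_{K₁} = τ} g⁻¹𝔞 = (τ⁻¹ N_{K/K₁}𝔞)𝓞_K`**
  (the fibre over `τ` is a coset of `Gal(K/K₁)`; Neukirch III (1.6) (iv)).
* §2 **`isPrincipal_prod_comap_pow_stickelberger_lift`** — for `b < f` and every non-zero ideal `𝔞` of `𝓞 K`,
  `∏_{g ∈ Gal(K/ℚ)} (g⁻¹𝔞)^{E_b(g|_{K₁})} = ((N𝔞)^{res (b−σ_b)θ})𝓞_K` is PRINCIPAL (Stickelberger for `K₁`);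
  `prod_mulEquiv_pow_stickelberger_lift_eq_one` — the same on every class of `Cl(K)`.
* §3 `sum_smul_pClassGroupRep_inv_eq_zero` — the operator `T_b = Σ_g E_b(g|_{K₁}) ρ(g⁻¹)` is ZERO on
  `ℤ_p ⊗ Cl(K)`; **`classGroupChiComponent_eq_bot_of_isUnit_stickelberger`** — if the scalar
  `s_b = Σ_g E_b(g|_{K₁}) ψ(g⁻¹) ∈ ℤ_p` is a unit then `e_ψ(ℤ_p ⊗ Cl K) = 0` (`p ∤ [K:ℚ]`; on the eigenspace
  `T_b` acts by `s_b`).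
* §4 `coe_sum_stickelberger_scalar_eq` — if `ψ(g) = χ(c(σ))` whenever `g|_{K₁} = σ|_{K₁}` (a character `χ`
  mod `f` with values in `ℚ_p`), then `s_b = [K:K₁] · Σ_{u ∈ (ℤ/f)ˣ} ⌊bu/f⌋ χ(u)⁻¹` in `ℚ_p`.
* §5 `natCast_mul_sum_floor_mul_inv_eq` — `f·Σ_u ⌊bu/f⌋ χ(u)⁻¹ = (b − χ(b))·Σ_u u χ(u)⁻¹` for `b` prime to `f`
  (Lang's «`(b − σ_b)θ ε(χ) = (b − χ(b))B_{1,χ̄} ε(χ)`»), and the main theorem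
  **`classGroupChiComponent_eq_bot_of_norm_bernoulliSum_eq_one`**: if for some `b < f` prime to `f` both
  `b − χ(b)` and `(1/f)Σ_{u ∈ (ℤ/f)ˣ} u·χ(u)⁻¹` (`= B_{1,χ⁻¹}` for `χ ≠ 1`) are `p`-adic units, then
  **`classGroupChiComponent ℚ K p ψ = ⊥`**.

HONEST FRAMING. This is the Stickelberger–Herbrand direction «unit `B_{1,χ⁻¹}` ⟹ trivial `χ`-eigenspace» —
the ONLY direction of Mazur–Wiles 1984 Thm. 2 (tree: `MazurWiles1984.thm2_card_oddChiClassGroup_eq_bernoulli`,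
a named fact) that the consumers in `Summits/BirchSwinnertonDyer/…/Theorems/PrintCFramBottomClassIndexLawFiveLeHerbrand*`
use (root lemma `classGroupChiComponent_eq_bot_of_norm_bernoulli_eq_one (h : MW)` of
`ImaginaryAbelianFieldOddChiClassNumber.lean`). Here it is PROVED, for `K ⊇ K₁ ⊆ ℚ(μ_f)` given as data; the passage
from the `Γ_ℚ`-dictionary `ψ(τ̄) = χ(χ_f(τ))` to such a `K₁ ↪ ℚ(μ_f)` is a separate (Galois-theoretic) step. The converse
(Ribet ∕ Mazur–Wiles proper) is not touched. BSD is not proved by any of this.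

## References

* [Lang1990] S. Lang, *Cyclotomic Fields I and II*, GTM 121 (1990), Ch. 1 §2 Thm. 2.3, §3 Thm. 3.1, Cor. 3.
* [Washington1997] L. C. Washington, *Introduction to Cyclotomic Fields*, 2nd ed., GTM 83 (1997), Thm. 6.10, §6.3.
* [NeukirchANT1999] J. Neukirch, *Algebraic Number Theory* (1999), Ch. III §1 Prop. (1.6) (iv).
* [Solomon1990] D. Solomon, Ann. Inst. Fourier 40 (1990), §II.1 Lemma II.1 (the `χ`-eigenspace for `p ∤ |G|`).
-/

noncomputable section

namespace Literature.NumberTheory.NumberFields.HerbrandStickelberger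

open _root_.NumberField IsDedekindDomain Finset
open Literature.NumberTheory.GaussSums Literature.NumberTheory.GaussSums.JacobiSumIdeal
open Literature.RepresentationTheory.FiniteGroups
open scoped Pointwise Classical nonZeroDivisors

variable {K : Type} [Field K] [NumberField K] [IsGalois ℚ K]
variable {K₁ : Type} [Field K₁] [NumberField K₁] [Algebra K₁ K] [IsScalarTower ℚ K₁ K] [Normal ℚ K₁]
  [IsGalois K₁ K]

/-! ### §1 The fibres of `Gal(K/ℚ) → Gal(K₁/ℚ)` and the relative norm -/

omit [IsGalois ℚ K] [IsGalois K₁ K] in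
/-- An automorphism of `K` restricting to the identity of the normal subfield `K₁` is `K₁`-linear. [folklore] -/
private theorem exists_restrictScalars_eq {g : K ≃ₐ[ℚ] K} (hg : g.restrictNormal K₁ = 1) :
    ∃ h : K ≃ₐ[K₁] K, h.restrictScalars ℚ = g := by
  have hfix : ∀ x : K₁, g (algebraMap K₁ K x) = algebraMap K₁ K x := fun x => by
    rw [← AlgEquiv.restrictNormal_commutes, hg, AlgEquiv.one_apply]
  exact ⟨AlgEquiv.ofRingEquiv (f := (g : K ≃+* K)) hfix, rfl⟩

omit [IsGalois ℚ K] [IsGalois K₁ K] in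
/-- Restriction to `K₁` is multiplicative. [folklore] -/
private theorem restrictNormal_mul (a b : K ≃ₐ[ℚ] K) :
    (a * b).restrictNormal K₁ = a.restrictNormal K₁ * b.restrictNormal K₁ :=
  map_mul (AlgEquiv.restrictNormalHom K₁) a b

omit [IsGalois ℚ K] [IsGalois K₁ K] in
/-- Restriction to `K₁` commutes with inverses. [folklore] -/
private theorem restrictNormal_inv (a : K ≃ₐ[ℚ] K) : a⁻¹.restrictNormal K₁ = (a.restrictNormal K₁)⁻¹ :=
  map_inv (AlgEquiv.restrictNormalHom K₁) a

omit [IsGalois ℚ K] [IsGalois K₁ K] in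
/-- `h ∈ Gal(K/K₁)` restricts to the identity of `K₁`. [folklore] -/
private theorem restrictNormal_restrictScalars (h : K ≃ₐ[K₁] K) :
    (h.restrictScalars ℚ).restrictNormal K₁ = 1 := by
  refine AlgEquiv.ext fun x => (algebraMap K₁ K).injective ?_
  rw [AlgEquiv.restrictNormal_commutes, AlgEquiv.one_apply]
  exact h.commutes x

omit [IsGalois ℚ K] [Normal ℚ K₁] [IsGalois K₁ K] in
/-- The two pointwise actions of `h ∈ Gal(K/K₁) ⊆ Gal(K/ℚ)` on ideals agree. [folklore] -/
private theorem restrictScalars_smul (h : K ≃ₐ[K₁] K) (𝔞 : Ideal (𝓞 K)) :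
    (h.restrictScalars ℚ) • 𝔞 = h • 𝔞 := by
  rw [Ideal.pointwise_smul_def, Ideal.pointwise_smul_def]
  rfl

/-- **The fibre of `Gal(K/ℚ) → Gal(K₁/ℚ)` over `τ` collects the conjugates: `∏_{g|_{K₁} = τ} g⁻¹𝔞 =
(τ⁻¹ N_{K/K₁}𝔞)𝓞_K`** (Neukirch III (1.6) (iv) `N(𝔞)𝓞_K = ∏_{h ∈ Gal(K/K₁)} h𝔞`, translated by a lift
`g₀` of `τ`). [cite: NeukirchANT1999, Ch. III §1 Prop. (1.6) (iv)] -/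
theorem prod_filter_comap_eq_map_comap_relNorm (τ : K₁ ≃ₐ[ℚ] K₁) (𝔞 : Ideal (𝓞 K)) :
    ∏ g ∈ univ.filter (fun g : K ≃ₐ[ℚ] K => g.restrictNormal K₁ = τ),
        𝔞.comap (RingOfIntegers.mapRingEquiv (g : K ≃+* K)) =
      ((Ideal.relNorm (𝓞 K₁) 𝔞).comap (RingOfIntegers.mapRingEquiv (τ : K₁ ≃+* K₁))).map
        (algebraMap (𝓞 K₁) (𝓞 K)) := by
  -- a lift `g₀` of `τ`
  obtain ⟨g₀, hg₀⟩ := AlgEquiv.restrictNormalHom_surjective (F := ℚ) (K₁ := K₁) (E := K) τ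
  change g₀.restrictNormal K₁ = τ at hg₀
  rw [← hg₀, ← comap_map_algebraMap_eq (M := K) g₀, ← NumberField.prod_smul_eq_map_relNorm K₁ K 𝔞,
    ← StickelbergerFactorisation.inv_smul_eq_comap_mapRingEquiv, Finset.smul_prod']
  -- reindex the fibre by `Gal(K/K₁)`: `h ↦ h⁻¹ g₀`
  symm
  refine Finset.prod_nbij (fun h : K ≃ₐ[K₁] K => (h.restrictScalars ℚ)⁻¹ * g₀) ?_ ?_ ?_ ?_
  · intro h _
    rw [mem_filter]
    refine ⟨mem_univ _, ?_⟩
    rw [restrictNormal_mul, restrictNormal_inv, restrictNormal_restrictScalars, inv_one, one_mul]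
  · intro h₁ _ h₂ _ h12
    have : h₁.restrictScalars ℚ = h₂.restrictScalars ℚ := inv_injective (mul_right_cancel h12)
    exact AlgEquiv.ext fun x => AlgEquiv.congr_fun this x
  · intro g hg
    rw [Finset.mem_coe, mem_filter] at hg
    have hres : (g₀ * g⁻¹).restrictNormal K₁ = 1 := by
      rw [restrictNormal_mul, restrictNormal_inv, hg.2, mul_inv_cancel]
    obtain ⟨h, hh⟩ := exists_restrictScalars_eq hres
    refine ⟨h, Finset.mem_coe.mpr (mem_univ _), ?_⟩
    dsimp only
    rw [hh, mul_inv_rev, inv_inv, inv_mul_cancel_right]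
  · intro h _
    rw [← StickelbergerFactorisation.inv_smul_eq_comap_mapRingEquiv, mul_inv_rev, inv_inv, mul_smul,
      restrictScalars_smul]

/-! ### §2 Stickelberger's relation on the ideals and ideal classes of `K ⊇ K₁ ⊆ ℚ(μ_f)` -/

section KLevel

variable {f : ℕ} [NeZero f] {M : Type} [Field M] [NumberField M] [hM : IsCyclotomicExtension {f} ℚ M]
  [Algebra K₁ M] [IsScalarTower ℚ K₁ M] [IsGalois K₁ M]

/-- **The restriction of `(b − σ_b)θ(f)` to `K` kills the ideals of `K`**: for `K ⊇ K₁ ⊆ M = ℚ(μ_f)`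
(`K/ℚ` Galois, `K₁/ℚ` normal), `b < f` and every non-zero ideal `𝔞` of `𝓞 K`,
`∏_{g ∈ Gal(K/ℚ)} (g⁻¹𝔞)^{E_b(g|_{K₁})}` is principal, `E_b(τ) = Σ_{σ ∈ Gal(M/ℚ), σ|_{K₁} = τ} ⌊b·c(σ)/f⌋`
(it is `((N_{K/K₁}𝔞)^{res (b−σ_b)θ})𝓞_K`, principal by Stickelberger's theorem for `K₁ ⊆ ℚ(μ_f)`).
[cite: Washington1997, Thm. 6.10] [cite: Lang1990, Ch. 1 §2 Thm. 2.3] -/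
theorem isPrincipal_prod_comap_pow_stickelberger_lift {b : ℕ} (hb : b < f) {𝔞 : Ideal (𝓞 K)}
    (h𝔞 : 𝔞 ≠ ⊥) :
    (∏ g : K ≃ₐ[ℚ] K, (𝔞.comap (RingOfIntegers.mapRingEquiv (g : K ≃+* K))) ^
        (∑ σ ∈ univ.filter (fun σ : M ≃ₐ[ℚ] M => σ.restrictNormal K₁ = g.restrictNormal K₁),
          b * ((IsCyclotomicExtension.Rat.galEquivZMod f M σ : (ZMod f)ˣ) : ZMod f).val / f)).IsPrincipal := by
  have h𝔟 : Ideal.relNorm (𝓞 K₁) 𝔞 ≠ ⊥ := by rw [Ne, Ideal.relNorm_eq_bot_iff]; exact h𝔞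
  -- Stickelberger for `K₁ ⊆ M` on the class of `N𝔞`
  obtain ⟨γ₀, hγ₀⟩ := (ClassGroup.mk0_eq_one_iff _).mp
    (mk0_prod_comap_pow_stickelberger_subfield_eq_one (K₁ := K₁) (M := M) hb h𝔟)
  -- regroup along the fibres of `g ↦ g|_{K₁}`
  have hregroup : ∏ g : K ≃ₐ[ℚ] K, (𝔞.comap (RingOfIntegers.mapRingEquiv (g : K ≃+* K))) ^
        (∑ σ ∈ univ.filter (fun σ : M ≃ₐ[ℚ] M => σ.restrictNormal K₁ = g.restrictNormal K₁),
          b * ((IsCyclotomicExtension.Rat.galEquivZMod f M σ : (ZMod f)ˣ) : ZMod f).val / f) =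
      (∏ τ : K₁ ≃ₐ[ℚ] K₁, ((Ideal.relNorm (𝓞 K₁) 𝔞).comap
          (RingOfIntegers.mapRingEquiv (τ : K₁ ≃+* K₁))) ^
        (∑ σ ∈ univ.filter (fun σ : M ≃ₐ[ℚ] M => σ.restrictNormal K₁ = τ),
          b * ((IsCyclotomicExtension.Rat.galEquivZMod f M σ : (ZMod f)ˣ) : ZMod f).val / f)).map
        (algebraMap (𝓞 K₁) (𝓞 K)) := by
    rw [← Ideal.mapHom_apply, map_prod]
    simp_rw [map_pow, Ideal.mapHom_apply, ← prod_filter_comap_eq_map_comap_relNorm]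
    rw [← prod_fiberwise univ (fun g : K ≃ₐ[ℚ] K => g.restrictNormal K₁)]
    refine prod_congr rfl fun τ _ => ?_
    rw [← Finset.prod_pow]
    refine prod_congr rfl fun g hg => ?_
    rw [(mem_filter.mp hg).2]
  rw [hregroup]
  change (Ideal.map (algebraMap (𝓞 K₁) (𝓞 K)) _).IsPrincipal
  rw [show (∏ τ : K₁ ≃ₐ[ℚ] K₁, ((Ideal.relNorm (𝓞 K₁) 𝔞).comap
          (RingOfIntegers.mapRingEquiv (τ : K₁ ≃+* K₁))) ^
        (∑ σ ∈ univ.filter (fun σ : M ≃ₐ[ℚ] M => σ.restrictNormal K₁ = τ),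
          b * ((IsCyclotomicExtension.Rat.galEquivZMod f M σ : (ZMod f)ˣ) : ZMod f).val / f)) =
      Ideal.span {γ₀} from hγ₀, Ideal.map_span, Set.image_singleton]
  exact ⟨⟨algebraMap (𝓞 K₁) (𝓞 K) γ₀, rfl⟩⟩

omit [IsGalois ℚ K] [IsScalarTower ℚ K₁ K] [Normal ℚ K₁] [IsGalois K₁ K] in
/-- `g⁻¹[𝔞] = [g⁻¹𝔞] = [𝔞.comap g]` for the action of `Gal(K/ℚ)` on `Cl(K)` through
`ClassGroup.mulEquiv (AmbiguousClass.intAut ·)`. [folklore] -/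
private theorem mulEquiv_intAut_inv_mk0 (g : K ≃ₐ[ℚ] K) (I : (Ideal (𝓞 K))⁰) :
    ClassGroup.mulEquiv (AmbiguousClass.intAut g⁻¹) (ClassGroup.mk0 I) =
      ClassGroup.mk0 ⟨(I : Ideal (𝓞 K)).comap (RingOfIntegers.mapRingEquiv (g : K ≃+* K)),
        mem_nonZeroDivisors_iff_ne_zero.mpr (by
          rw [Ne, Ideal.zero_eq_bot, ← Ideal.map_symm,
            Ideal.map_eq_bot_iff_of_injective (RingOfIntegers.mapRingEquiv (g : K ≃+* K)).symm.injective]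
          exact nonZeroDivisors.ne_zero I.2)⟩ := by
  rw [AmbiguousClass.mulEquiv_mk0]
  congr 1
  refine Subtype.ext ?_
  change (I : Ideal (𝓞 K)).map _ = (I : Ideal (𝓞 K)).comap _
  rw [← Ideal.map_symm]
  rfl

/-- **Stickelberger's relation on `Cl(K)`**: `∏_{g ∈ Gal(K/ℚ)} (g⁻¹·C)^{E_b(g|_{K₁})} = 1` for every ideal
class `C` of `K ⊇ K₁ ⊆ ℚ(μ_f)` and `b < f`. [cite: Washington1997, Thm. 6.10] [cite: Lang1990, Ch. 1 §2 Thm. 2.3] -/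
theorem prod_mulEquiv_pow_stickelberger_lift_eq_one {b : ℕ} (hb : b < f) (C : ClassGroup (𝓞 K)) :
    ∏ g : K ≃ₐ[ℚ] K, (ClassGroup.mulEquiv (AmbiguousClass.intAut g⁻¹) C) ^
        (∑ σ ∈ univ.filter (fun σ : M ≃ₐ[ℚ] M => σ.restrictNormal K₁ = g.restrictNormal K₁),
          b * ((IsCyclotomicExtension.Rat.galEquivZMod f M σ : (ZMod f)ˣ) : ZMod f).val / f) = 1 := by
  obtain ⟨I, rfl⟩ := ClassGroup.mk0_surjective C
  have hI : (I : Ideal (𝓞 K)) ≠ ⊥ := nonZeroDivisors.ne_zero I.2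
  simp_rw [mulEquiv_intAut_inv_mk0, ← map_pow]
  rw [← map_prod, ClassGroup.mk0_eq_one_iff]
  have h := isPrincipal_prod_comap_pow_stickelberger_lift (K₁ := K₁) (M := M) hb hI
  convert h using 1
  rw [Submonoid.coe_finsetProd]
  exact Finset.prod_congr rfl fun σ _ => rfl

end KLevel

/-! ### §3 The Stickelberger operator on `ℤ_p ⊗ Cl(K)` and the `ψ`-eigenspace -/

section ChiPart

variable {p : ℕ} [Fact p.Prime]
variable {f : ℕ} [NeZero f] {M : Type} [Field M] [NumberField M] [hM : IsCyclotomicExtension {f} ℚ M]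
  [Algebra K₁ M] [IsScalarTower ℚ K₁ M] [IsGalois K₁ M]

/-- **The Stickelberger operator `T_b = Σ_{g ∈ Gal(K/ℚ)} E_b(g|_{K₁})·ρ(g⁻¹)` vanishes on `ℤ_p ⊗ Cl(K)`**
(`K ⊇ K₁ ⊆ ℚ(μ_f)`, `b < f`): on `1 ⊗ [𝔞]` it is `1 ⊗ [∏_g (g⁻¹𝔞)^{E_b(g|)}] = 1 ⊗ 0`.
[cite: Washington1997, Thm. 6.10] [cite: Lang1990, Ch. 1 §2 Thm. 2.3] -/
theorem sum_smul_pClassGroupRep_inv_eq_zero {b : ℕ} (hb : b < f)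
    (x : TensorProduct ℤ ℤ_[p] (Additive (ClassGroup (𝓞 K)))) :
    ∑ g : K ≃ₐ[ℚ] K,
      (∑ σ ∈ univ.filter (fun σ : M ≃ₐ[ℚ] M => σ.restrictNormal K₁ = g.restrictNormal K₁),
          b * ((IsCyclotomicExtension.Rat.galEquivZMod f M σ : (ZMod f)ˣ) : ZMod f).val / f) •
        pClassGroupRep ℚ K p g⁻¹ x = 0 := by
  induction x using TensorProduct.induction_on with
  | zero => simp only [map_zero, smul_zero, sum_const_zero]
  | tmul a c =>
    simp_rw [pClassGroupRep, baseChangeRep_apply_tmul, ← TensorProduct.tmul_smul, ← TensorProduct.tmul_sum]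
    have h : ∑ g : K ≃ₐ[ℚ] K,
        (∑ σ ∈ univ.filter (fun σ : M ≃ₐ[ℚ] M => σ.restrictNormal K₁ = g.restrictNormal K₁),
            b * ((IsCyclotomicExtension.Rat.galEquivZMod f M σ : (ZMod f)ˣ) : ZMod f).val / f) •
          classGroupRep ℚ K g⁻¹ c = 0 := by
      have h1 := congrArg Additive.ofMul
        (prod_mulEquiv_pow_stickelberger_lift_eq_one (K := K) (K₁ := K₁) (M := M) hb (Additive.toMul c))
      rw [ofMul_one, ofMul_prod] at h1
      rw [← h1]
      refine sum_congr rfl fun g _ => ?_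
      rw [ofMul_pow, ← classGroupRep_apply]
      rfl
    rw [h, TensorProduct.tmul_zero]
  | add x y hx hy =>
    simp_rw [map_add, smul_add, sum_add_distrib, hx, hy, add_zero]

/-- **The `ψ`-eigenspace of `ℤ_p ⊗ Cl(K)` is killed by the scalar `s_b = Σ_g E_b(g|_{K₁})·ψ(g⁻¹)`; if
`s_b ∈ ℤ_pˣ` it vanishes** (`p ∤ [K:ℚ]`, so `e_ψ(ℤ_p ⊗ Cl K)` is the `ψ`-eigenspace, Solomon's Lemma II.1).
[cite: Lang1990, Ch. 1 §3 Thm. 3.1 (the ideal `B_{1,χ̄} I_χ` annihilates `𝒞^{(p)}(χ)`)] [cite: Washington1997, Thm. 6.10] -/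
theorem classGroupChiComponent_eq_bot_of_isUnit_stickelberger (hpK : ¬ p ∣ Module.finrank ℚ K)
    (ψ : (K ≃ₐ[ℚ] K) →* ℤ_[p]ˣ) {b : ℕ} (hb : b < f)
    (hunit : IsUnit (∑ g : K ≃ₐ[ℚ] K,
      ((∑ σ ∈ univ.filter (fun σ : M ≃ₐ[ℚ] M => σ.restrictNormal K₁ = g.restrictNormal K₁),
          b * ((IsCyclotomicExtension.Rat.galEquivZMod f M σ : (ZMod f)ˣ) : ZMod f).val / f : ℕ) : ℤ_[p]) *
        ((ψ g⁻¹ : ℤ_[p]ˣ) : ℤ_[p]))) :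
    classGroupChiComponent ℚ K p (fun g => ((ψ g : ℤ_[p]ˣ) : ℤ_[p])) = ⊥ := by
  rw [Submodule.eq_bot_iff]
  intro x hx
  have hx' := (mem_classGroupChiComponent_iff hpK ψ x).mp hx
  have h0 := sum_smul_pClassGroupRep_inv_eq_zero (K := K) (K₁ := K₁) (M := M) (p := p) hb x
  simp_rw [hx', ← Nat.cast_smul_eq_nsmul ℤ_[p], smul_smul, ← sum_smul] at h0
  obtain ⟨u, hu⟩ := hunit
  rw [← hu] at h0
  have h1 := congrArg (fun y => u⁻¹ • y) h0
  simp only [smul_zero] at h1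
  rwa [← Units.smul_def, inv_smul_smul] at h1

/-! ### §4 The scalar `s_b = Σ_g E_b(g|_{K₁}) ψ(g⁻¹) = [K:K₁]·(b − χ(b))·B_{1,χ⁻¹}` -/

omit [IsGalois K₁ K] in
/-- The fibres of `Gal(K/ℚ) → Gal(K₁/ℚ)` all have `[K:K₁] = #Gal(K/K₁)` elements. [folklore] -/
private theorem card_filter_restrictNormal_eq (τ : K₁ ≃ₐ[ℚ] K₁) :
    (univ.filter (fun g : K ≃ₐ[ℚ] K => g.restrictNormal K₁ = τ)).card = Fintype.card (K ≃ₐ[K₁] K) := by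
  obtain ⟨g₀, hg₀⟩ := AlgEquiv.restrictNormalHom_surjective (F := ℚ) (K₁ := K₁) (E := K) τ
  change g₀.restrictNormal K₁ = τ at hg₀
  rw [← Finset.card_univ]
  symm
  refine Finset.card_nbij (fun h : K ≃ₐ[K₁] K => (h.restrictScalars ℚ)⁻¹ * g₀) ?_ ?_ ?_
  · intro h _
    rw [Finset.mem_coe, mem_filter]
    refine ⟨mem_univ _, ?_⟩
    rw [restrictNormal_mul, restrictNormal_inv, restrictNormal_restrictScalars, inv_one, one_mul, hg₀]
  · intro h₁ _ h₂ _ h12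
    have : h₁.restrictScalars ℚ = h₂.restrictScalars ℚ := inv_injective (mul_right_cancel h12)
    exact AlgEquiv.ext fun x => AlgEquiv.congr_fun this x
  · intro g hg
    rw [Finset.mem_coe, mem_filter] at hg
    have hres : (g₀ * g⁻¹).restrictNormal K₁ = 1 := by
      rw [restrictNormal_mul, restrictNormal_inv, hg.2, hg₀, mul_inv_cancel]
    obtain ⟨h, hh⟩ := exists_restrictScalars_eq hres
    refine ⟨h, Finset.mem_coe.mpr (mem_univ _), ?_⟩
    dsimp only
    rw [hh, mul_inv_rev, inv_inv, inv_mul_cancel_right]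

omit [IsGalois K₁ K] [IsGalois K₁ M] in
/-- **`s_b = [K:K₁] · Σ_{u ∈ (ℤ/f)ˣ} ⌊bu/f⌋ χ(u)⁻¹` in `ℚ_p`**: if `ψ(g) = χ(c(σ))` whenever `g|_{K₁} = σ|_{K₁}`
(`χ` a character mod `f`, `c : Gal(ℚ(μ_f)/ℚ) ≅ (ℤ/f)ˣ`), the Stickelberger scalar of the `ψ`-eigenspace is
`[K:K₁]` times `χ⁻¹((b − σ_b)θ(f)) = Σ_c ⌊bc/f⌋ χ̄(c)`. [cite: Lang1990, Ch. 1 §3 (proof of Thm. 3.1: the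
eigenvalue of `(b − σ_b)θ` on `𝒞^{(p)}(χ)`)] [cite: Washington1997, §6.3 (proof of Thm. 6.13 / Herbrand's theorem)] -/
theorem coe_sum_stickelberger_scalar_eq (ψ : (K ≃ₐ[ℚ] K) →* ℤ_[p]ˣ) (χ : MulChar (ZMod f) ℚ_[p])
    (hψχ : ∀ (g : K ≃ₐ[ℚ] K) (σ : M ≃ₐ[ℚ] M), g.restrictNormal K₁ = σ.restrictNormal K₁ →
      (((ψ g : ℤ_[p]ˣ) : ℤ_[p]) : ℚ_[p]) =
        χ ((IsCyclotomicExtension.Rat.galEquivZMod f M σ : (ZMod f)ˣ) : ZMod f))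
    (b : ℕ) :
    ((∑ g : K ≃ₐ[ℚ] K,
      ((∑ σ ∈ univ.filter (fun σ : M ≃ₐ[ℚ] M => σ.restrictNormal K₁ = g.restrictNormal K₁),
          b * ((IsCyclotomicExtension.Rat.galEquivZMod f M σ : (ZMod f)ˣ) : ZMod f).val / f : ℕ) : ℤ_[p]) *
        ((ψ g⁻¹ : ℤ_[p]ˣ) : ℤ_[p]) : ℤ_[p]) : ℚ_[p]) =
      (Fintype.card (K ≃ₐ[K₁] K) : ℚ_[p]) *
        ∑ u : (ZMod f)ˣ, ((b * (u : ZMod f).val / f : ℕ) : ℚ_[p]) * (χ (u : ZMod f))⁻¹ := by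
  -- `ψ(g⁻¹) = χ(c(σ))⁻¹` along the fibres
  have hinv : ∀ (g : K ≃ₐ[ℚ] K) (σ : M ≃ₐ[ℚ] M), g.restrictNormal K₁ = σ.restrictNormal K₁ →
      (((ψ g⁻¹ : ℤ_[p]ˣ) : ℤ_[p]) : ℚ_[p]) =
        (χ ((IsCyclotomicExtension.Rat.galEquivZMod f M σ : (ZMod f)ˣ) : ZMod f))⁻¹ := by
    intro g σ h
    refine eq_inv_of_mul_eq_one_left ?_
    rw [← hψχ g σ h, ← PadicInt.coe_mul, ← Units.val_mul, ← map_mul, inv_mul_cancel, map_one,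
      Units.val_one, PadicInt.coe_one]
  rw [show ∀ z : ℤ_[p], (z : ℚ_[p]) = PadicInt.Coe.ringHom z from fun z => rfl, map_sum]
  simp_rw [map_mul, map_natCast]
  -- expand the inner sums and swap
  simp_rw [Nat.cast_sum, Finset.sum_mul]
  rw [Finset.sum_comm' (s := (univ : Finset (K ≃ₐ[ℚ] K)))
    (t := fun g : K ≃ₐ[ℚ] K =>
      univ.filter (fun σ : M ≃ₐ[ℚ] M => σ.restrictNormal K₁ = g.restrictNormal K₁))
    (t' := (univ : Finset (M ≃ₐ[ℚ] M)))
    (s' := fun σ : M ≃ₐ[ℚ] M => univ.filter (fun g : K ≃ₐ[ℚ] K => g.restrictNormal K₁ = σ.restrictNormal K₁))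
    (fun g σ => by simp only [mem_univ, true_and, mem_filter, and_true, eq_comm])]
  -- each inner sum is constant on the fibre
  have hfib : ∀ σ : M ≃ₐ[ℚ] M,
      ∑ g ∈ univ.filter (fun g : K ≃ₐ[ℚ] K => g.restrictNormal K₁ = σ.restrictNormal K₁),
        ((b * ((IsCyclotomicExtension.Rat.galEquivZMod f M σ : (ZMod f)ˣ) : ZMod f).val / f : ℕ) : ℚ_[p]) *
          PadicInt.Coe.ringHom ((ψ g⁻¹ : ℤ_[p]ˣ) : ℤ_[p]) =
      (Fintype.card (K ≃ₐ[K₁] K) : ℚ_[p]) *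
        (((b * ((IsCyclotomicExtension.Rat.galEquivZMod f M σ : (ZMod f)ˣ) : ZMod f).val / f : ℕ) : ℚ_[p]) *
          (χ ((IsCyclotomicExtension.Rat.galEquivZMod f M σ : (ZMod f)ˣ) : ZMod f))⁻¹) := by
    intro σ
    rw [Finset.sum_congr rfl fun g hg => by
      rw [show PadicInt.Coe.ringHom ((ψ g⁻¹ : ℤ_[p]ˣ) : ℤ_[p]) = _ from hinv g σ (mem_filter.mp hg).2],
      Finset.sum_const, card_filter_restrictNormal_eq, nsmul_eq_mul]
  simp_rw [hfib, ← Finset.mul_sum]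
  congr 1
  exact (Fintype.sum_equiv (IsCyclotomicExtension.Rat.galEquivZMod f M).toEquiv _ _ fun σ => rfl)

end ChiPart

/-! ### §5 `Σ_u ⌊bu/f⌋ χ̄(u) = (b − χ(b))·B_{1,χ̄}` and the Herbrand direction -/

section Bernoulli

variable {p : ℕ} [Fact p.Prime] {f : ℕ} [NeZero f]

/-- **`f · Σ_{u ∈ (ℤ/f)ˣ} ⌊bu/f⌋ χ(u)⁻¹ = (b − χ(b)) · Σ_{u ∈ (ℤ/f)ˣ} u χ(u)⁻¹`** for `b` prime to `f`
(`f⌊bu/f⌋ = bu − ⟨bu⟩` and `u ↦ bu` permutes `(ℤ/f)ˣ`): the eigenvalue of `(b − σ_b)θ(f)` on the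
`χ`-eigenspace is `(b − χ(b))B_{1,χ̄}` (Lang: «`(b − σ_b)θ ε(χ) = (b − χ(b)) B_{1,χ̄} ε(χ)`»).
[cite: Lang1990, Ch. 1 §3 (proof of Thm. 3.1)] [cite: Washington1997, §6.3 (proof of Thm. 6.13)] -/
theorem natCast_mul_sum_floor_mul_inv_eq (χ : MulChar (ZMod f) ℚ_[p]) {b : ℕ} (hbu : IsUnit (b : ZMod f)) :
    (f : ℚ_[p]) * ∑ u : (ZMod f)ˣ, ((b * (u : ZMod f).val / f : ℕ) : ℚ_[p]) * (χ (u : ZMod f))⁻¹ =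
      ((b : ℚ_[p]) - χ (b : ZMod f)) * ∑ u : (ZMod f)ˣ, (((u : ZMod f).val : ℕ) : ℚ_[p]) * (χ (u : ZMod f))⁻¹ := by
  set β : (ZMod f)ˣ := hbu.unit with hβ
  have hβb : ((β : (ZMod f)ˣ) : ZMod f) = (b : ZMod f) := hbu.unit_spec
  -- `f⌊bu/f⌋ = b·u − (bu mod f)`
  have key : ∀ u : (ZMod f)ˣ, (f : ℚ_[p]) * ((b * (u : ZMod f).val / f : ℕ) : ℚ_[p]) =
      (b : ℚ_[p]) * (((u : ZMod f).val : ℕ) : ℚ_[p]) - ((((β * u : (ZMod f)ˣ) : ZMod f).val : ℕ) : ℚ_[p]) := by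
    intro u
    have hval : ((β * u : (ZMod f)ˣ) : ZMod f).val = b * (u : ZMod f).val % f := by
      rw [Units.val_mul, hβb, ZMod.val_mul, ZMod.val_natCast, Nat.mod_mul_mod]
    have hdm := Nat.div_add_mod (b * (u : ZMod f).val) f
    rw [hval, eq_sub_iff_add_eq]
    exact_mod_cast hdm
  -- `Σ_u ⟨bu⟩ χ(u)⁻¹ = χ(b) Σ_u u χ(u)⁻¹`
  have hχb0 : χ (b : ZMod f) ≠ 0 := (hbu.map χ).ne_zero
  have hperm : ∑ u : (ZMod f)ˣ, ((((β * u : (ZMod f)ˣ) : ZMod f).val : ℕ) : ℚ_[p]) * (χ (u : ZMod f))⁻¹ =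
      χ (b : ZMod f) * ∑ u : (ZMod f)ˣ, (((u : ZMod f).val : ℕ) : ℚ_[p]) * (χ (u : ZMod f))⁻¹ := by
    rw [Finset.mul_sum]
    refine Fintype.sum_equiv (Equiv.mulLeft β) _ _ fun u => ?_
    simp only [Equiv.coe_mulLeft]
    have hχu0 : χ (u : ZMod f) ≠ 0 := (u.isUnit.map χ).ne_zero
    rw [show ((β * u : (ZMod f)ˣ) : ZMod f) = (b : ZMod f) * (u : ZMod f) by rw [Units.val_mul, hβb],
      map_mul]
    field_simp
  calc (f : ℚ_[p]) * ∑ u : (ZMod f)ˣ, ((b * (u : ZMod f).val / f : ℕ) : ℚ_[p]) * (χ (u : ZMod f))⁻¹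
      = ∑ u : (ZMod f)ˣ, ((f : ℚ_[p]) * ((b * (u : ZMod f).val / f : ℕ) : ℚ_[p])) * (χ (u : ZMod f))⁻¹ := by
        rw [Finset.mul_sum]
        exact Finset.sum_congr rfl fun u _ => by ring
    _ = (b : ℚ_[p]) * ∑ u : (ZMod f)ˣ, (((u : ZMod f).val : ℕ) : ℚ_[p]) * (χ (u : ZMod f))⁻¹ -
          ∑ u : (ZMod f)ˣ, ((((β * u : (ZMod f)ˣ) : ZMod f).val : ℕ) : ℚ_[p]) * (χ (u : ZMod f))⁻¹ := by
        simp_rw [key, sub_mul, Finset.sum_sub_distrib, mul_assoc, ← Finset.mul_sum]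
    _ = ((b : ℚ_[p]) - χ (b : ZMod f)) *
          ∑ u : (ZMod f)ˣ, (((u : ZMod f).val : ℕ) : ℚ_[p]) * (χ (u : ZMod f))⁻¹ := by
        rw [hperm, sub_mul]

end Bernoulli

section Main

variable {p : ℕ} [Fact p.Prime]
variable {f : ℕ} [NeZero f] {M : Type} [Field M] [NumberField M] [hM : IsCyclotomicExtension {f} ℚ M]
  [Algebra K₁ M] [IsScalarTower ℚ K₁ M] [IsGalois K₁ M]

/-- **THE HERBRAND DIRECTION, UNCONDITIONALLY (Stickelberger): `B_{1,χ⁻¹}` a `p`-adic unit ⟹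
`e_ψ(ℤ_p ⊗ Cl K) = 0`.** Let `K/ℚ` be Galois with `p ∤ [K:ℚ]`, `K₁ ⊆ K` a normal subfield embedded in
`M = ℚ(μ_f)`, `ψ : Gal(K/ℚ) → ℤ_pˣ` and `χ` a character mod `f` with `ψ(g) = χ(c(σ))` whenever
`g|_{K₁} = σ|_{K₁}` (so `ψ` is `χ` read on `Gal(K/ℚ)` through `K₁ ⊆ ℚ(μ_f)`). If for some `b < f` prime to
`f` both `b − χ(b)` and `B = (1/f)Σ_{u ∈ (ℤ/f)ˣ} u χ(u)⁻¹` (`= B_{1,χ⁻¹}` for `χ ≠ 1`) are `p`-adic units, then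
the `ψ`-component of `ℤ_p ⊗ Cl(K)` is trivial — Lang's Thm. 3.1 «`B_{1,χ̄} I_χ` annihilates `𝒞^{(p)}(χ)`» for an
abelian field inside `ℚ(μ_f)`, with NO appeal to Mazur–Wiles. [cite: Lang1990, Ch. 1 §3 Thm. 3.1 and Cor. 3 (Herbrand)] [cite: Washington1997, Thm. 6.10 and §6.3] -/
theorem classGroupChiComponent_eq_bot_of_norm_bernoulliSum_eq_one (hpK : ¬ p ∣ Module.finrank ℚ K)
    (ψ : (K ≃ₐ[ℚ] K) →* ℤ_[p]ˣ) (χ : MulChar (ZMod f) ℚ_[p])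
    (hψχ : ∀ (g : K ≃ₐ[ℚ] K) (σ : M ≃ₐ[ℚ] M), g.restrictNormal K₁ = σ.restrictNormal K₁ →
      (((ψ g : ℤ_[p]ˣ) : ℤ_[p]) : ℚ_[p]) =
        χ ((IsCyclotomicExtension.Rat.galEquivZMod f M σ : (ZMod f)ˣ) : ZMod f))
    {b : ℕ} (hb : b < f) (hbu : IsUnit (b : ZMod f)) (hbχ : ‖(b : ℚ_[p]) - χ (b : ZMod f)‖ = 1)
    (hB : ‖(∑ u : (ZMod f)ˣ, (((u : ZMod f).val : ℕ) : ℚ_[p]) * (χ (u : ZMod f))⁻¹) / (f : ℚ_[p])‖ = 1) :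
    classGroupChiComponent ℚ K p (fun g => ((ψ g : ℤ_[p]ˣ) : ℤ_[p])) = ⊥ := by
  refine classGroupChiComponent_eq_bot_of_isUnit_stickelberger (K₁ := K₁) (M := M) hpK ψ hb ?_
  rw [PadicInt.isUnit_iff, PadicInt.norm_def, coe_sum_stickelberger_scalar_eq (K₁ := K₁) ψ χ hψχ b,
    norm_mul]
  -- `p ∤ [K:K₁]`
  have hN : ‖(Fintype.card (K ≃ₐ[K₁] K) : ℚ_[p])‖ = 1 := by
    rw [Padic.norm_natCast_eq_one_iff]
    refine (Nat.Prime.coprime_iff_not_dvd (Fact.out : p.Prime)).mpr fun h => hpK ?_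
    rw [Fintype.card_eq_nat_card, IsGalois.card_aut_eq_finrank] at h
    rw [← Module.finrank_mul_finrank ℚ K₁ K]
    exact Dvd.dvd.mul_left h _
  -- the Bernoulli factor
  have hf0 : (f : ℚ_[p]) ≠ 0 := by exact_mod_cast NeZero.ne f
  have hS : ∑ u : (ZMod f)ˣ, ((b * (u : ZMod f).val / f : ℕ) : ℚ_[p]) * (χ (u : ZMod f))⁻¹ =
      ((b : ℚ_[p]) - χ (b : ZMod f)) *
        ((∑ u : (ZMod f)ˣ, (((u : ZMod f).val : ℕ) : ℚ_[p]) * (χ (u : ZMod f))⁻¹) / (f : ℚ_[p])) := by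
    rw [mul_div_assoc', eq_div_iff hf0, mul_comm, natCast_mul_sum_floor_mul_inv_eq χ hbu]
  rw [hS, norm_mul, hN, hbχ, hB, one_mul, one_mul]

end Main

end Literature.NumberTheory.NumberFields.HerbrandStickelberger
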